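import Summits.BirchSwinnertonDyer.Rank1Residual.P2.CellsAtTwoStatus
import Summits.BirchSwinnertonDyer.Rank1Residual.X5.RationalTwoTorsionPoints
import Literature.NumberTheory.EllipticCurves.Greenberg1999.TwoTorsionMuInvariant
import Literature.NumberTheory.EllipticCurves.PAdicBSD
import HarnessLib

/-!
# Sub-lane «bsd-p2»: SCOPE ON THE GRID of the `p = 2`-capable records already typed in the tree
# (Kato 2004 Thm 17.4 (1)(2) and Thm 14.2/14.3 at `2`; Greenberg 1999 Prop 5.14 at `2`) — which
# cells of the partition at `2` each record quantifies over, and what it delivers there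

HONEST FRAMING (sub-lane «bsd-p2», run/shared/lean/b2b/bsd-rank1-residual/p2/, verbatim in every
file): the target of record is the FULL Birch–Swinnerton-Dyer formula for EVERY analytic-rank `≤ 1`
`E/ℚ` at ALL primes INCLUDING `2`; the odd-prime class ledger is referee A's; the `2`-part is OPEN
(cells O1 = X5 ∖ CM and O12 = the CM corner) and under census by «bsd-p2». Census / instrument
output at `2` = EVIDENCE / conjecture items with held-out validation, NEVER a Literature fact;
certificates close PAIRS (one isogeny class, `p = 2`), never classes. This file asserts NO
arithmetic fact and introduces NO named fact: it reads three records ALREADY typed as printed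
(`kato_divisibility_allPrimes W 2` — Kato 2004 Thm 17.4 (1)(2), p2-ref TYPING PASS 2026-08-21T23:10Z;
`kato_finite_of_L_one_ne_zero W 2` — Kato Thm 14.2/14.3, bsd.S20; `Greenberg1999.prop514_isTorsion_mu_eq_zero_two`
— LNM 1716 Prop 5.14 at `2`, p2-ref TYPING PASS) and proves, per record, over WHICH CELLS of
`P2.CellAtTwo` its printed hypotheses are implied by the cell predicate (the SCOPE, a `Bool` on cells,
so that the census column `lit_row` / PLAN.md §2 "covered in print" is COMPUTED, not asserted —
p2-lead PLAN.md §4 rule and order (2) "Kato-at-2 scope statement"), and WHAT the record then delivers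
at `2` — never `BSD(E,2)`: an upper-bound divisibility with `2`-power slack (17.4), finiteness of
`Ш[2^∞]` and `Sel_{2^∞}` (14.3), or `μ = 0` (5.14). The two records that DO close cells at `2`
(Rubin/Burungale–Flach CM rank `0`; Li–Tian–Yan–Zhu 2025) are the status table of
`P2/CellsAtTwoStatus.lean` and are not repeated. Unit `b2b-bsdres-p2-typer`; locators from
p2-lit-3's `HOME/p2/lit/LIT3-SCOPE.md` rows T3-K5, T3-K9 and p2-ref REFEREE.md §3a.

## Contents

* §1 Kato Thm 17.4 (1)(2) at `2`: scope = the good-ORDINARY row (`c.red = goodOrd`; its typed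
  hypothesis `IsOrdinaryAt W 2` IS `X5.O1.CellGoodOrd W`); `16` consistent cells (8 open-O1, 4
  covered-C8, 4 covered-LTYZ); delivers `X(E/ℚ_∞)` torsion and `char X ∣ 2ⁿ·L₂` (O1's
  `KatoDivisibilityAtTwoUpTo`, `k` unbounded — cited, not re-typed).
* §2 Kato Thm 14.2/14.3 at `2` (bsd.S20): scope = the rank-`0` half (`c.r1 = false`; hypothesis
  `L(E,1) ≠ 0` from the rank bit by modularity); `40` consistent cells; delivers `E(ℚ)`, `Ш(E)[2^∞]`,
  `Sel_{2^∞}` finite — finiteness, not the `2`-valuation.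
* §3 Greenberg Prop 5.14 at `2`: scope = (good ordinary ∨ multiplicative at `2`) ∧ a rational point
  of order `2` (`c.img = borel`), PLUS a non-grid per-curve datum (the point is "ramified at `2` XOR
  odd", a census column); `8` consistent cells (`6` open-O1; the `2` CM-split good-ordinary `borel`
  cells are covered); delivers `Sel` `Λ`-cotorsion and `μ = 0` — the input of O1's α doors
  (`X5.O1.bsdp_two_of_prop514_of_lowerBound_auto`).
* §4 The `lit_row`-support summary: on the `56` OPEN cells no typed record concludes `BSD(E,2)`; the
  records above reach `8` / `20` / `6` of them with PARTIAL conclusions (counted by `decide`).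

References: Kato, Astérisque 295 (2004) Thm 17.4, 14.2–14.3 [Kato2004Asterisque]; Greenberg, LNM 1716
(1999) Prop 5.14 [GreenbergLNM1716]; HOME/p2/lit/LIT3-SCOPE.md (T3-K5, T3-K9); class-closure/O1/TYPING.md.
-/

noncomputable section

open scoped Classical MatrixGroups ModularForm

open CongruenceSubgroup WeierstrassCurve Literature.NumberTheory.EllipticCurves
  Literature.NumberTheory.EllipticCurves.ModularForms
  Literature.NumberTheory.EllipticCurves.Rank1Residual
  Literature.NumberTheory.EllipticCurves.Rank1Residual.Typed

set_option autoImplicit false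

namespace Summit.BirchSwinnertonDyer.Rank1Residual.P2

/-! ## §1 Kato 2004 Thm 17.4 (1)(2) at `2` -/

/-- SCOPE of Kato Thm 17.4 (1)(2) at `2` on the grid: the good-ordinary row. [cite: Kato2004Asterisque, Thm. 17.4 (1)(2) (p. 273)] -/
def scopeKato174 (c : CellAtTwo) : Bool := decide (c.red = .goodOrd)

/-- **The typed hypothesis of `kato_divisibility_allPrimes W 2` holds on every cell of the scope**:
`IsOrdinaryAt W 2` (good reduction at `2` and `2 ∤ a₂`) is literally the cell condition
`X5.O1.CellGoodOrd W = GoodOrd W 2`. [cite: Kato2004Asterisque, Thm. 17.4 (1)(2) (p. 273)] -/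
theorem isOrdinaryAt_two_of_holdsAt {c : CellAtTwo} (hc : scopeKato174 c = true)
    {W : WeierstrassCurve ℚ} [W.IsElliptic] [W.IsGloballyMinimal] (hW : c.HoldsAt W) :
    IsOrdinaryAt W 2 := by
  have hred : c.red = .goodOrd := of_decide_eq_true hc
  obtain ⟨-, hred', -, -⟩ := hW
  rw [hred] at hred'
  exact hred'

/-- Conversely, off the scope the hypothesis fails: a curve in a cell with `c.red ≠ goodOrd` is not
good ordinary at `2` (disjointness of the reduction axis). [folklore] -/
theorem not_isOrdinaryAt_two_of_holdsAt {c : CellAtTwo} (hc : scopeKato174 c = false)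
    {W : WeierstrassCurve ℚ} [W.IsElliptic] [W.IsGloballyMinimal] (hW : c.HoldsAt W) :
    ¬ IsOrdinaryAt W 2 := by
  intro hgo
  have hred : c.red ≠ .goodOrd := by simpa [scopeKato174] using hc
  obtain ⟨-, hred', -, -⟩ := hW
  exact hred (RedTwo.eq_of_holdsAt W hred' (show RedTwo.goodOrd.HoldsAt W from hgo))

/-- **What 17.4 (1)(2) delivers at `2` on its scope** (pointer, nothing new): for every cyclotomic
datum and newform `f` of `W`, `X` is `Λ`-torsion and `char_Λ X ∋ g` with `ι g = 2ⁿ·L₂(f, α)` for SOME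
`n` — O1's `KatoDivisibilityAtTwoUpTo W k f` for `k` unbounded (`X5.O1.katoDivisibilityAtTwoUpTo_of_allPrimes`);
an UPPER-bound ingredient with `2`-power slack, not `BSD(E,2)`. Here: the fact instantiated at `2` on a
scope cell. [cite: Kato2004Asterisque, Thm. 17.4 (1)(2) (p. 273)] -/
theorem kato174_at_two_on_scope {c : CellAtTwo} (hc : scopeKato174 c = true)
    {W : WeierstrassCurve ℚ} [W.IsElliptic] [W.IsGloballyMinimal] (hW : c.HoldsAt W)
    {N : ℕ} [NeZero N] {f : CuspForm (Gamma0 N) 2} (hK : kato_divisibility_allPrimes W 2 (f := f))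
    (hf : IsNewformOf W f)
    (κ : ZpExtension ℚ 2) (γ : Field.absoluteGaloisGroup ℚ) (hκ : κ.IsCyclotomic)
    (hγ : κ.IsTopGenerator γ) (hγ' : IsCyclotomicVariable 2 γ) (D : W.SelmerDualData κ γ) :
    D.IsTorsion ∧ ∃ (n : ℕ) (g : IwasawaAlgebra 2), g ∈ D.charIdeal ∧
      iwasawaToPowerSeries 2 g =
        PowerSeries.C ((2 : ℚ_[2]) ^ n) * padicLFunction f (unitRoot W 2 : ℚ_[2]) :=
  hK κ γ hκ hγ hγ' (isOrdinaryAt_two_of_holdsAt hc hW) hf D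

/-- Scope count: `16` consistent cells, of which `8` open (the O1 good-ordinary sub-cell, both
ranks, four image values), `4` covered-C8 and `4` covered-LTYZ. Kernel count. [folklore] -/
theorem scopeKato174_counts :
    (CellAtTwo.all.filter fun c => c.Consistent && scopeKato174 c).length = 16 ∧
    (CellAtTwo.all.filter fun c => scopeKato174 c && decide (c.status = .openO1 .goodOrd)).length = 8 ∧
    (CellAtTwo.all.filter fun c => scopeKato174 c && decide (c.status = .coveredC8)).length = 4 ∧
    (CellAtTwo.all.filter fun c => scopeKato174 c && decide (c.status = .coveredLTYZ)).length = 4 := by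
  refine ⟨?_, ?_, ?_, ?_⟩ <;> decide +kernel

/-! ## §2 Kato 2004 Thm 14.2 / 14.3 at `2` (bsd.S20) -/

/-- SCOPE of Kato Thm 14.2/14.3 at `2`: the rank-`0` half of the grid. [cite: Kato2004Asterisque, Thm. 14.2 and Cor. 14.3 (p. 235)] -/
def scopeKato143 (c : CellAtTwo) : Bool := !c.r1

/-- **The printed hypothesis `L(E,1) ≠ 0` of Thm 14.2/14.3 holds on the scope** (rank bit `0`, read
through modularity `hasEntireLFunction_rat`). [cite: Kato2004Asterisque, Thm. 14.2 and Cor. 14.3 (p. 235)] -/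
theorem L_one_ne_zero_of_holdsAt (hmod : hasEntireLFunction_rat) {c : CellAtTwo}
    (hc : scopeKato143 c = true) {W : WeierstrassCurve ℚ} [W.IsElliptic] [W.IsGloballyMinimal]
    (hW : c.HoldsAt W) : W.analyticRank = 0 ∧ W.entireLFunction 1 ≠ 0 := by
  have hr1 : c.r1 = false := by simpa [scopeKato143] using hc
  obtain ⟨hrk, -, -, -⟩ := hW
  have hr : W.analyticRank = 0 := by
    have := analyticRank_eq_of_rankBitHoldsAt hrk
    simpa [hr1] using this
  exact ⟨hr, (W.analyticRank_eq_zero_iff_holds (hmod W)).mp hr⟩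

/-- **What 14.2/14.3 delivers at `2` on its scope**: `E(ℚ)`, `Ш(E/ℚ)[2^∞]` and `Sel_{2^∞}(E/ℚ)` are
FINITE (the fact `kato_finite_of_L_one_ne_zero W 2`, printed for every prime) — finiteness, not the
`2`-adic valuation of `#Ш`. [cite: Kato2004Asterisque, Thm. 14.2 and Cor. 14.3 (p. 235)] -/
theorem kato143_at_two_on_scope (hmod : hasEntireLFunction_rat) {c : CellAtTwo}
    (hc : scopeKato143 c = true) {W : WeierstrassCurve ℚ} [W.IsElliptic] [W.IsGloballyMinimal]
    (hK : kato_finite_of_L_one_ne_zero W 2) (hW : c.HoldsAt W) :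
    Finite W.toAffine.Point ∧ Finite (AddCommGroup.primaryComponent W.sha 2) ∧
      Finite (selmerGroupPInfty W 2) :=
  hK (L_one_ne_zero_of_holdsAt hmod hc hW).2

/-- Scope count: `40` consistent cells (`20` open-O1 rank-`0` cells + `20` covered-C8). Kernel count.
[folklore] -/
theorem scopeKato143_counts :
    (CellAtTwo.all.filter fun c => c.Consistent && scopeKato143 c).length = 40 ∧
    (CellAtTwo.all.filter fun c => scopeKato143 c && decide (c.status = .openO1 c.red)).length = 20 ∧
    (CellAtTwo.all.filter fun c => scopeKato143 c && decide (c.status = .coveredC8)).length = 20 := by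
  refine ⟨?_, ?_, ?_⟩ <;> decide +kernel

/-! ## §3 Greenberg 1999 Prop 5.14 at `2` -/

/-- SCOPE of Greenberg Prop 5.14 at `2` on the grid: good ordinary or multiplicative at `2`, and a
rational point of order `2` (image value `borel`). The third printed hypothesis — the point is
ramified at `2` XOR odd — is a per-curve datum below grid resolution (census column).
[cite: GreenbergLNM1716, Prop. 5.14 (chunk p0170)] -/
def scopeGreenberg514 (c : CellAtTwo) : Bool :=
  (decide (c.red = .goodOrd) || decide (c.red = .multSplit) || decide (c.red = .multNonsplit)) &&
    decide (c.img = .borel)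

/-- **The grid-level hypotheses of Prop 5.14 at `2` hold on the scope**: the reduction binder as
typed (`(good at 2 ∧ 2 ∤ a₂) ∨ multiplicative at 2`) and a rational point of exact order `2`
(`X5.O1.exists_addOrderOf_eq_two_of_red_two`, harvest-1's kernel theorem for O1's atom
`RationalTwoTorsion W = Red W 2`). [cite: GreenbergLNM1716, Prop. 5.14 (chunk p0170)] -/
theorem greenberg514_binders_of_holdsAt {c : CellAtTwo} (hc : scopeGreenberg514 c = true)
    {W : WeierstrassCurve ℚ} [W.IsElliptic] [W.IsGloballyMinimal] (hW : c.HoldsAt W) :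
    ((W.HasGoodReductionAtPrime 2 ∧ ¬ (2 : ℤ) ∣ W.frobeniusTrace 2) ∨
        W.HasMultiplicativeReductionAtPrime 2) ∧
      ∃ P : W.toAffine.Point, addOrderOf P = 2 := by
  have h : (c.red = .goodOrd ∨ c.red = .multSplit ∨ c.red = .multNonsplit) ∧ c.img = .borel := by
    simpa [scopeGreenberg514, or_assoc] using hc
  obtain ⟨hred, himg⟩ := h
  obtain ⟨-, hred', himg', -⟩ := hW
  rw [himg] at himg'
  refine ⟨?_, X5.O1.exists_addOrderOf_eq_two_of_red_two W himg'⟩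
  rcases hred with h | h | h <;> rw [h] at hred'
  · exact Or.inl hred'
  · exact Or.inr hred'.hasMultiplicativeReductionAtPrime
  · exact Or.inr hred'.1

/-- **What Prop 5.14 delivers at `2`** (given also the non-grid datum: a rational `2`-torsion point
`(x, y)` that is ramified-at-`2` XOR odd): `Sel_E(ℚ_∞)₂` is `Λ`-cotorsion and `μ_E = 0` — the `μ = 0`
input of O1's α doors; not `BSD(E,2)`. The fact instantiated on a scope cell.
[cite: GreenbergLNM1716, Prop. 5.14 (chunk p0170)] -/
theorem greenberg514_at_two_on_scope (hG : Greenberg1999.prop514_isTorsion_mu_eq_zero_two)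
    {c : CellAtTwo} (hc : scopeGreenberg514 c = true) {W : WeierstrassCurve ℚ} [W.IsElliptic]
    [W.IsGloballyMinimal] (hW : c.HoldsAt W) {x y : ℚ} (hxy : W.toAffine.Equation x y)
    (h2 : 2 * y + W.a₁ * x + W.a₃ = 0)
    (hdat : (Greenberg1999.TwoTorsionRamifiedAtTwo x ∧ ¬ Greenberg1999.TwoTorsionOdd W x) ∨
      (Greenberg1999.TwoTorsionOdd W x ∧ ¬ Greenberg1999.TwoTorsionRamifiedAtTwo x))
    (κ : ZpExtension ℚ 2) (γ : Field.absoluteGaloisGroup ℚ) (hκ : κ.IsCyclotomic)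
    (hγ : κ.IsTopGenerator γ) (D : W.SelmerDualData κ γ) : D.IsTorsion ∧ D.mu = 0 :=
  hG W (greenberg514_binders_of_holdsAt hc hW).1 x y hxy h2 hdat κ γ hκ hγ D

/-- Scope count: `8` consistent cells — `6` open-O1 (non-CM, `red ∈ {goodOrd, multSplit,
multNonsplit}`, `img = borel`, both ranks) and `2` covered (CM with `2` split, good ordinary, `borel`:
C8 at rank `0`, LTYZ at rank `1`; every other CM cell with these reduction values is inconsistent).
Kernel count. [folklore] -/
theorem scopeGreenberg514_counts :
    (CellAtTwo.all.filter fun c => c.Consistent && scopeGreenberg514 c).length = 8 ∧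
    (CellAtTwo.all.filter fun c => scopeGreenberg514 c && decide (c.status = .openO1 c.red)).length
      = 6 ∧
    (CellAtTwo.all.filter fun c => scopeGreenberg514 c &&
      (decide (c.status = .coveredC8) || decide (c.status = .coveredLTYZ))).length = 2 := by
  refine ⟨?_, ?_, ?_⟩ <;> decide +kernel

/-! ## §4 Summary for the `lit_row` column -/

/-- **On the `56` OPEN cells, what the typed `p = 2` records reach** (kernel count): Kato 17.4 (1)(2)
reaches the `8` open good-ordinary cells (upper-bound divisibility with `2`-power slack); Kato 14.3
reaches the `20` open rank-`0` cells (all O1; O12 is rank `1`) with finiteness only; Greenberg 5.14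
reaches `6` open cells with `μ = 0` (given its per-curve datum). NONE of them concludes `BSD(E,2)` on
any open cell — the closing records at `2` are exactly the two of the status table (C8, LTYZ).
[folklore] -/
theorem open_cells_reached_counts :
    (CellAtTwo.all.filter fun c => scopeKato174 c &&
      (decide (c.status = .openO12) || decide (c.status = .openO1 c.red))).length = 8 ∧
    (CellAtTwo.all.filter fun c => scopeKato143 c &&
      (decide (c.status = .openO12) || decide (c.status = .openO1 c.red))).length = 20 ∧
    (CellAtTwo.all.filter fun c => scopeGreenberg514 c &&
      (decide (c.status = .openO12) || decide (c.status = .openO1 c.red))).length = 6 := by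
  refine ⟨?_, ?_, ?_⟩ <;> decide +kernel

end Summit.BirchSwinnertonDyer.Rank1Residual.P2

end
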